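import Literature.NumberTheory.Automorphic.ParabolicGL
import HarnessLib

/-!
# Conjugation on the unipotent radical of a two-block parabolic of `GL_n`, in box coordinates:
# `p Φ(x) p⁻¹ = Φ(P_{II} X (P⁻¹)_{JJ})` and the twisted commutators `u p u⁻¹ = Φ((1 - K_p) x) p`

Topic `NumberTheory/Automorphic`; namespace `Literature.NumberTheory.Automorphic`. KERNEL mathematics
only: theorems, no definition, no named fact, no instance, no `sorry`. Pure algebra over a commutative
ring `R`; the measure-theoretic consequence (the change of variables
`∫_U φ(u p u⁻¹) du = ‖det(1 - K_p)‖_F⁻¹ ∫_U φ(u p) du` over a non-archimedean local field) is the sequel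
`GLnTwoBlockUnipotentChangeOfVariables`.

Let `c : n → Bool` be a two-block labelling of a finite index type, `I = {c = false}` (first block),
`J = {c = true}` (second block), `P_c ≤ GL_n(R)` the standard parabolic (`standardParabolicGL R c`,
block upper triangular) and `U_c` its unipotent radical (`unipotentRadicalP R c`), an abelian group
with BOX COORDINATES `Φ : R^{I × J} → U_c`, `Φ(x) = 1 + X` (`X` the matrix supported on the box
`I × J` with entries `x`; `exists_boxHomeomorph_unipotentRadicalP` of `GLnMaximalParabolicLocalModulus`
delivers such a `Φ` as a homeomorphism, with the entry formula, additivity `Φ(x + y) = Φ(x) Φ(y)`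
and the conjugation by block SCALARS). The theorems below take ANY `Φ` with the entry formula
(hypothesis `hΦ`, copied token for token from that theorem) and additivity (`hΦadd`), and compute the
conjugation action of the WHOLE parabolic:

* `parabolic_conj_boxChart` — **`p Φ(x) p⁻¹ = Φ(K_p x)`** for EVERY `p ∈ P_c` (not only Levi elements), where
  `(K_p x)_{ij} = Σ_{i' ∈ I, j' ∈ J} p_{i i'} x_{i' j'} (p⁻¹)_{j' j}`, i.e. `X ↦ P_{II} X (P⁻¹)_{JJ}`: the
  off-diagonal block of `p` drops out since box matrices have square zero. `K_p` is written as the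
  explicit `(I × J) × (I × J)` matrix `(K_p)_{(i,j),(i',j')} = p_{i i'} (p⁻¹)_{j' j}` acting through
  `Matrix.toLin'` — no definition is introduced;
* `boxChart_zero`, `boxChart_neg`, `boxChart_sub` — additivity bookkeeping (`Φ(0) = 1`, `Φ(-x) = Φ(x)⁻¹`);
* **`boxChart_mul_conj_eq`: `Φ(x) p Φ(x)⁻¹ = Φ((1 - K_p) x) · p`** and
  **`boxChart_inv_mul_conj_eq`: `Φ(x)⁻¹ p Φ(x) = p · Φ((1 - K'_p) x)`** with `K'_p = K_{p⁻¹}` — the twisted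
  commutators are the LINEAR maps `1 - K_p`, `1 - K'_p` of the box (this is the substitution «by a
  change of variables» in Rogawski's proof of Lemma 4.13.1, p. 70, for `P ⊂ GL_3` of type `(2, 1)`);
* `parabolic_apply_mul_inv_apply_eq_one_of_forall_eq`, **`det_one_sub_boxAd_eq_of_forall_eq`** — for a maximal
  parabolic of type `(n-1, 1)` (`J = {j₀}`): `p_{j₀j₀} (p⁻¹)_{j₀j₀} = 1` and
  `(p⁻¹)_{j₀j₀}^{#I} · det(p_{j₀j₀} · 1 - P_{II}) = det(1 - K_p)`; for `p = diag(A, λ)` the scalar is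
  `λ^{-#I} det(λ - A)`, non-zero exactly when `λ` is not an eigenvalue of `A` («`p` is
  `(G, M)`-regular»; Rogawski p. 70: `|(1 - γ₂γ₁⁻¹)(1 - γ₂γ₃⁻¹)|_w`).

## References

* [BernsteinZelevinsky1977] I. N. Bernstein, A. V. Zelevinsky, *Induced representations of reductive
  `p`-adic groups I*, Ann. Sci. ÉNS 10 (1977), §2.1 (`P_β = G_β ⋉ U_β`), 1.7 (the module of an inner
  automorphism).
* [Rogawski1990] J. D. Rogawski, *Automorphic Representations of Unitary Groups in Three Variables*,
  Ann. of Math. Stud. 123 (1990), §4.13, Lemma 4.13.1 (a) p. 69 and its proof pp. 69–70 (held text, read).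
-/

noncomputable section

open scoped MatrixGroups
open Matrix

namespace Literature.NumberTheory.Automorphic

/-! ### 1. Algebra: `p (1 + X) p⁻¹ = 1 + P_{II} X (P⁻¹)_{JJ}` for every `p ∈ P_c` -/

section Algebra

variable {R : Type*} [CommRing R] {n : Type*} [Fintype n] [DecidableEq n] {c : n → Bool}

omit [DecidableEq n] in
/-- A sum over a subtype `{k // P k}` as a sum over the ambient finite type with a `dite`.
[folklore] -/
private theorem sum_subtype_eq_sum_dite {M : Type*} [AddCommMonoid M] (pr : n → Prop)
    [DecidablePred pr] (f : {k // pr k} → M) :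
    ∑ k : {k // pr k}, f k = ∑ k : n, if h : pr k then f ⟨k, h⟩ else 0 := by
  classical
  have h1 : ∑ k : n, (if h : pr k then f ⟨k, h⟩ else 0) =
      ∑ k ∈ Finset.univ.filter pr, (if h : pr k then f ⟨k, h⟩ else 0) := by
    refine (Finset.sum_filter_of_ne fun k _ hk => ?_).symm
    by_contra hP
    exact hk (dif_neg hP)
  have h2 : ∑ k ∈ Finset.univ.filter pr, (if h : pr k then f ⟨k, h⟩ else 0) =
      ∑ k : {k // pr k}, (if h : pr (k : n) then f ⟨k, h⟩ else 0) :=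
    Finset.sum_subtype (Finset.univ.filter pr) (fun k => by simp) _
  rw [h1, h2]
  refine Finset.sum_congr rfl fun k _ => ?_
  rw [dif_pos k.2]

/-- **Conjugation by the parabolic on its unipotent radical, in box coordinates.** Let
`c : n → Bool` be a two-block labelling, `I = {c = false}`, `J = {c = true}`, and let `Φ` be box
coordinates on the unipotent radical `U_c` of `P_c` (`Φ(x) = 1 + X`, `X` the matrix supported on
the box `I × J` with entries `x`, as delivered by `exists_boxHomeomorph_unipotentRadicalP`). Then for
EVERY `p ∈ P_c` (not only for Levi elements) `p Φ(x) p⁻¹ = Φ(x')` with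
`x'_{ij} = Σ_{i' ∈ I, j' ∈ J} p_{i i'} x_{i' j'} (p⁻¹)_{j' j}`, i.e. `X' = P_{II} X (P⁻¹)_{JJ}`: the
off-diagonal block of `p` drops out because `X Y = 0` for box matrices. (Bernstein–Zelevinsky 1977,
§2.1: `P_β = G_β ⋉ U_β`; the adjoint action of `P` on the abelian `U ≅ 𝔲 = Hom(F^J, F^I)`.)
[cite: BernsteinZelevinsky1977, §2.1] -/
theorem parabolic_conj_boxChart
    (Φ : ({i : n // c i = false} × {j : n // c j = true} → R) → ↥(unipotentRadicalP R c))
    (hΦ : ∀ x (i j : n), (((Φ x : standardParabolicGL R c) : GL n R) : Matrix n n R) i j =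
      (if i = j then 1 else 0) +
        if h : c i = false ∧ c j = true then x (⟨i, h.1⟩, ⟨j, h.2⟩) else 0)
    (p : standardParabolicGL R c) (x : {i : n // c i = false} × {j : n // c j = true} → R) :
    p * (Φ x : standardParabolicGL R c) * p⁻¹ =
      (Φ (Matrix.toLin'
        (Matrix.of fun q q' : {i : n // c i = false} × {j : n // c j = true} =>
          ((p : GL n R) : Matrix n n R) q.1 q'.1 *
            (((p⁻¹ : standardParabolicGL R c) : GL n R) : Matrix n n R) q'.2 q.2) x) :
        standardParabolicGL R c) := by
  classical
  -- notation
  set P : Matrix n n R := ((p : GL n R) : Matrix n n R) with hP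
  set Q : Matrix n n R := (((p⁻¹ : standardParabolicGL R c) : GL n R) : Matrix n n R) with hQ
  set B : ({i : n // c i = false} × {j : n // c j = true} → R) → Matrix n n R :=
    fun y => Matrix.of fun k l =>
      if h : c k = false ∧ c l = true then y (⟨k, h.1⟩, ⟨l, h.2⟩) else 0 with hBdef
  have hBapply : ∀ y k l, B y k l =
      if h : c k = false ∧ c l = true then y (⟨k, h.1⟩, ⟨l, h.2⟩) else 0 := fun y k l => rfl
  have hΦmat : ∀ y, (((Φ y : standardParabolicGL R c) : GL n R) : Matrix n n R) = 1 + B y := by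
    intro y
    ext i j
    rw [hΦ, Matrix.add_apply, Matrix.one_apply, hBapply]
  have hPQ : P * Q = 1 := by
    rw [hP, hQ, ← Units.val_mul, ← Subgroup.coe_mul, mul_inv_cancel, Subgroup.coe_one, Units.val_one]
  have hPtri : P.BlockTriangular c := blockTriangular_of_mem p
  have hQtri : Q.BlockTriangular c := blockTriangular_of_mem p⁻¹
  set x' : {i : n // c i = false} × {j : n // c j = true} → R := Matrix.toLin'
    (Matrix.of fun q q' : {i : n // c i = false} × {j : n // c j = true} =>
      P q.1 q'.1 * Q q'.2 q.2) x with hx'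
  have hx'apply : ∀ (i : {i : n // c i = false}) (j : {j : n // c j = true}),
      x' (i, j) = ∑ i' : {i : n // c i = false}, ∑ j' : {j : n // c j = true},
        P i i' * Q j' j * x (i', j') := by
    intro i j
    rw [hx', Matrix.toLin'_apply, Matrix.mulVec, dotProduct, Fintype.sum_prod_type]
    rfl
  -- the key matrix identity `P · B(x) · Q = B(x')`
  have hkey : P * B x * Q = B x' := by
    ext a b
    simp only [Matrix.mul_apply, Finset.sum_mul]
    rw [Finset.sum_comm]
    -- now: `∑ k, ∑ l, P a k * B x k l * Q l b = B x' a b`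
    by_cases hab : c a = false ∧ c b = true
    · rw [hBapply, dif_pos hab, hx'apply, sum_subtype_eq_sum_dite (fun k : n => c k = false)]
      refine Finset.sum_congr rfl fun k _ => ?_
      by_cases hk : c k = false
      · rw [dif_pos hk, sum_subtype_eq_sum_dite (fun l : n => c l = true)]
        refine Finset.sum_congr rfl fun l _ => ?_
        by_cases hl : c l = true
        · rw [dif_pos hl, hBapply, dif_pos ⟨hk, hl⟩]
          ring
        · rw [dif_neg hl, hBapply, dif_neg (fun h => hl h.2), mul_zero, zero_mul]
      · rw [dif_neg hk]
        refine Finset.sum_eq_zero fun l _ => ?_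
        rw [hBapply, dif_neg (fun h => hk h.1), mul_zero, zero_mul]
    · rw [hBapply, dif_neg hab]
      refine Finset.sum_eq_zero fun k _ => Finset.sum_eq_zero fun l _ => ?_
      by_cases hkl : c k = false ∧ c l = true
      · obtain ⟨hk, hl⟩ := hkl
        by_cases ha : c a = false
        · -- then `c b = false`, and `Q l b = 0` since `c b < c l`
          have hb : c b = false := by
            cases hcb : c b
            · rfl
            · exact absurd ⟨ha, hcb⟩ hab
          have hQlb : Q l b = 0 := hQtri (by rw [hb, hl]; exact Bool.false_lt_true)
          rw [hQlb, mul_zero]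
        · -- `c a = true`, and `P a k = 0` since `c k < c a`
          have ha' : c a = true := by
            cases hca : c a
            · exact absurd hca ha
            · rfl
          have hPak : P a k = 0 := hPtri (by rw [hk, ha']; exact Bool.false_lt_true)
          rw [hPak, zero_mul, zero_mul]
      · rw [hBapply, dif_neg hkl, mul_zero, zero_mul]
  -- conclude in `P_c`
  apply Subtype.ext
  apply Units.ext
  rw [Subgroup.coe_mul, Subgroup.coe_mul, Units.val_mul, Units.val_mul, hΦmat, hΦmat,
    mul_add, mul_one, add_mul, hPQ, hkey]

/-- `Φ(0) = 1` for additive box coordinates `Φ(x + y) = Φ(x) Φ(y)` (`U_β ≅ (R^{I×J}, +)`).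
[cite: BernsteinZelevinsky1977, §2.1] -/
theorem boxChart_zero {U : Type*} [Group U] {V : Type*} [AddGroup V] (Φ : V → U)
    (hΦadd : ∀ x y, Φ (x + y) = Φ x * Φ y) : Φ 0 = 1 := by
  have h : Φ 0 * Φ 0 = Φ 0 * 1 := by rw [mul_one, ← hΦadd, add_zero]
  exact mul_left_cancel h

/-- `Φ(-x) = Φ(x)⁻¹` for additive box coordinates. [cite: BernsteinZelevinsky1977, §2.1] -/
theorem boxChart_neg {U : Type*} [Group U] {V : Type*} [AddGroup V] (Φ : V → U)
    (hΦadd : ∀ x y, Φ (x + y) = Φ x * Φ y) (x : V) : Φ (-x) = (Φ x)⁻¹ := by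
  apply eq_inv_of_mul_eq_one_right
  rw [← hΦadd, add_neg_cancel, boxChart_zero Φ hΦadd]

/-- `Φ(x - y) = Φ(x) Φ(y)⁻¹` for additive box coordinates. [cite: BernsteinZelevinsky1977, §2.1] -/
theorem boxChart_sub {U : Type*} [Group U] {V : Type*} [AddGroup V] (Φ : V → U)
    (hΦadd : ∀ x y, Φ (x + y) = Φ x * Φ y) (x y : V) : Φ (x - y) = Φ x * (Φ y)⁻¹ := by
  rw [sub_eq_add_neg, hΦadd, boxChart_neg Φ hΦadd]

/-- **The twisted commutator `u p u⁻¹`, in box coordinates**: for `u = Φ(x) ∈ U_c` and `p ∈ P_c`,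
`Φ(x) p Φ(x)⁻¹ = Φ((1 - K_p) x) · p` where `K_p` is the matrix of `Ad(p)` on the box
(`(K_p)_{(i,j),(i',j')} = p_{i i'} (p⁻¹)_{j' j}`, `parabolic_conj_boxChart`). This is the substitution behind
the descent of orbital integrals to a Levi subgroup (Rogawski 1990, proof of Lemma 4.13.1, p. 70:
«by a change of variables»). [cite: Rogawski1990, §4.13, proof of Lemma 4.13.1, p. 70] -/
theorem boxChart_mul_conj_eq
    (Φ : ({i : n // c i = false} × {j : n // c j = true} → R) → ↥(unipotentRadicalP R c))
    (hΦ : ∀ x (i j : n), (((Φ x : standardParabolicGL R c) : GL n R) : Matrix n n R) i j =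
      (if i = j then 1 else 0) +
        if h : c i = false ∧ c j = true then x (⟨i, h.1⟩, ⟨j, h.2⟩) else 0)
    (hΦadd : ∀ x y, Φ (x + y) = Φ x * Φ y)
    (p : standardParabolicGL R c) (x : {i : n // c i = false} × {j : n // c j = true} → R) :
    (Φ x : standardParabolicGL R c) * p * (Φ x : standardParabolicGL R c)⁻¹ =
      (Φ (Matrix.toLin'
        (1 - Matrix.of fun q q' : {i : n // c i = false} × {j : n // c j = true} =>
          ((p : GL n R) : Matrix n n R) q.1 q'.1 *
            (((p⁻¹ : standardParabolicGL R c) : GL n R) : Matrix n n R) q'.2 q.2) x) :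
        standardParabolicGL R c) * p := by
  have hgrp : ∀ u q : standardParabolicGL R c, u * q * u⁻¹ = u * (q * u⁻¹ * q⁻¹) * q := by
    intro u q; group
  rw [hgrp, ← Subgroup.coe_inv, ← boxChart_neg Φ hΦadd, parabolic_conj_boxChart Φ hΦ p (-x), ← Subgroup.coe_mul,
    ← hΦadd, map_neg, ← sub_eq_add_neg, map_sub, Matrix.toLin'_one, LinearMap.sub_apply,
    LinearMap.id_apply]

/-- **The twisted commutator `u⁻¹ p u`, in box coordinates**: `Φ(x)⁻¹ p Φ(x) = p · Φ((1 - K'_p) x)`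
with `(K'_p)_{(i,j),(i',j')} = (p⁻¹)_{i i'} p_{j' j}` the matrix of `Ad(p⁻¹)` on the box.
[cite: Rogawski1990, §4.13, proof of Lemma 4.13.1, p. 70] -/
theorem boxChart_inv_mul_conj_eq
    (Φ : ({i : n // c i = false} × {j : n // c j = true} → R) → ↥(unipotentRadicalP R c))
    (hΦ : ∀ x (i j : n), (((Φ x : standardParabolicGL R c) : GL n R) : Matrix n n R) i j =
      (if i = j then 1 else 0) +
        if h : c i = false ∧ c j = true then x (⟨i, h.1⟩, ⟨j, h.2⟩) else 0)
    (hΦadd : ∀ x y, Φ (x + y) = Φ x * Φ y)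
    (p : standardParabolicGL R c) (x : {i : n // c i = false} × {j : n // c j = true} → R) :
    (Φ x : standardParabolicGL R c)⁻¹ * p * (Φ x : standardParabolicGL R c) =
      p * (Φ (Matrix.toLin'
        (1 - Matrix.of fun q q' : {i : n // c i = false} × {j : n // c j = true} =>
          (((p⁻¹ : standardParabolicGL R c) : GL n R) : Matrix n n R) q.1 q'.1 *
            ((p : GL n R) : Matrix n n R) q'.2 q.2) x) :
        standardParabolicGL R c) := by
  have hgrp : ∀ u q : standardParabolicGL R c, u⁻¹ * q * u = q * (q⁻¹ * u⁻¹ * q⁻¹⁻¹) * u := by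
    intro u q; group
  have h := parabolic_conj_boxChart Φ hΦ p⁻¹ (-x)
  rw [hgrp, ← Subgroup.coe_inv, ← boxChart_neg Φ hΦadd, h, mul_assoc, ← Subgroup.coe_mul, ← hΦadd,
    map_neg, neg_add_eq_sub, map_sub, Matrix.toLin'_one, LinearMap.sub_apply, LinearMap.id_apply,
    inv_inv]

/-- The diagonal `J`-entry of `p⁻¹` is the inverse of that of `p` when the block `J = {c = true}`
is a single index `j₀` (a maximal parabolic of type `(n-1, 1)`): `p_{j₀ j₀} (p⁻¹)_{j₀ j₀} = 1`
(the diagonal blocks of `p⁻¹` are the inverses of those of `p`). [cite: BernsteinZelevinsky1977, §2.1] -/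
theorem parabolic_apply_mul_inv_apply_eq_one_of_forall_eq (p : standardParabolicGL R c)
    (j₀ : {j : n // c j = true}) (hj₀ : ∀ j : {j : n // c j = true}, j = j₀) :
    ((p : GL n R) : Matrix n n R) j₀ j₀ *
      (((p⁻¹ : standardParabolicGL R c) : GL n R) : Matrix n n R) j₀ j₀ = 1 := by
  classical
  have hPQ : ((p : GL n R) : Matrix n n R) * (((p⁻¹ : standardParabolicGL R c) : GL n R) :
      Matrix n n R) = 1 := by
    rw [← Units.val_mul, ← Subgroup.coe_mul, mul_inv_cancel, Subgroup.coe_one, Units.val_one]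
  have h := congr_fun (congr_fun hPQ (j₀ : n)) (j₀ : n)
  rw [Matrix.mul_apply, Matrix.one_apply_eq] at h
  rw [← h, Finset.sum_eq_single (j₀ : n)]
  · intro k _ hk
    by_cases hck : c k = true
    · exact absurd (congrArg Subtype.val (hj₀ ⟨k, hck⟩)) hk
    · have hck' : c k = false := by
        cases hc : c k
        · rfl
        · exact absurd hc hck
      have : ((p : GL n R) : Matrix n n R) j₀ k = 0 :=
        blockTriangular_of_mem p (by rw [hck', j₀.2]; exact Bool.false_lt_true)
      rw [this, zero_mul]
  · intro h; exact absurd (Finset.mem_univ _) h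

/-- **The scalar for a maximal parabolic of type `(n-1, 1)`.** When the second block is a single
index `j₀`, the box is `I × {j₀} ≃ I` and the matrix `K_p` of `Ad(p)` on the box is
`(p⁻¹)_{j₀ j₀} · P_{II}`, so that
`(p⁻¹)_{j₀ j₀}^{#I} · det(p_{j₀ j₀} · 1 - P_{II}) = det(1 - K_p)`; for `p = diag(A, λ)` this is
`λ^{-#I} det(λ - A)`, non-zero exactly when `λ` is not an eigenvalue of `A` (`p` is
«`(G, M)`-regular»; Rogawski 1990, p. 70: `|(1 - γ₂γ₁⁻¹)(1 - γ₂γ₃⁻¹)|_w`).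
[cite: Rogawski1990, §4.13, proof of Lemma 4.13.1, p. 70] -/
theorem det_one_sub_boxAd_eq_of_forall_eq (p : standardParabolicGL R c)
    (j₀ : {j : n // c j = true}) (hj₀ : ∀ j : {j : n // c j = true}, j = j₀) :
    (1 - Matrix.of fun q q' : {i : n // c i = false} × {j : n // c j = true} =>
          ((p : GL n R) : Matrix n n R) q.1 q'.1 *
            (((p⁻¹ : standardParabolicGL R c) : GL n R) : Matrix n n R) q'.2 q.2).det =
      (((p⁻¹ : standardParabolicGL R c) : GL n R) : Matrix n n R) j₀ j₀ ^
          Fintype.card {i : n // c i = false} *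
        (((p : GL n R) : Matrix n n R) j₀ j₀ •
            (1 : Matrix {i : n // c i = false} {i : n // c i = false} R) -
          Matrix.of fun i i' : {i : n // c i = false} =>
            ((p : GL n R) : Matrix n n R) i i').det := by
  classical
  haveI : Unique {j : n // c j = true} := ⟨⟨j₀⟩, hj₀⟩
  have hdef : (default : {j : n // c j = true}) = j₀ := hj₀ _
  set P : Matrix n n R := ((p : GL n R) : Matrix n n R) with hP
  set Q : Matrix n n R := (((p⁻¹ : standardParabolicGL R c) : GL n R) : Matrix n n R) with hQ
  set e : {i : n // c i = false} × {j : n // c j = true} ≃ {i : n // c i = false} :=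
    Equiv.prodUnique _ _ with he
  have hre : Matrix.reindex e e
      (1 - Matrix.of fun q q' : {i : n // c i = false} × {j : n // c j = true} =>
        P q.1 q'.1 * Q q'.2 q.2) =
      Q j₀ j₀ • (P j₀ j₀ • (1 : Matrix {i : n // c i = false} {i : n // c i = false} R) -
        Matrix.of fun i i' : {i : n // c i = false} => P i i') := by
    ext i i'
    have hs : ∀ i : {i : n // c i = false}, e.symm i = (i, j₀) := fun i => by
      rw [he, Equiv.prodUnique_symm_apply, hdef]
    have hPQ1 : P j₀ j₀ * Q j₀ j₀ = 1 := parabolic_apply_mul_inv_apply_eq_one_of_forall_eq p j₀ hj₀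
    simp only [Matrix.reindex_apply, Matrix.submatrix_apply, hs, Matrix.sub_apply, Matrix.one_apply,
      Matrix.of_apply, Matrix.smul_apply, smul_eq_mul, Prod.mk.injEq, and_true]
    by_cases hii : i = i'
    · subst hii
      simp only [if_true]
      linear_combination (-1 : R) * hPQ1
    · simp only [hii, if_false]
      ring
  rw [← Matrix.det_reindex_self e, hre, Matrix.det_smul, Fintype.card]

end Algebra

end Literature.NumberTheory.Automorphic
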